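import Summits.QuantumFields.YangMills.Theorems.BalabanUVNodesN22W1StripLastConditional

/-!
# BalabanUVNodes ∕ node N22 = NE9 — THE STRIP INDUCTION AT THE W1 OBJECT, MODULE 19′: THE KNIT WITH THE LAST COUPLING IN PRINT's CONDITIONAL SHAPE — `N22At` ∕ `S_N22`
# at the admissible reading of record on the (generated) towers of the runs of record from node N18 below + THREE PER-STEP GENERATOR SCHEMAS ((S-loc), (S-226): node
# N10; (S-last): node N09) + numerals; node N09's unconditional `EHoloAt` family is no longer an input

Cell `pub-ymgap`, HUMAN RULING D-0062 (Track A), R134 ACCELERATION re-seat `pub-ymgap-dag-n22-c` (strategy s1), generation 4, module 19′.  THEOREMS ONLY; imports module 18′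
`…N22W1StripLastConditional` (the self-feeding mixed producer `stripBound_termC_of_termwise226OnOlder_lastOn`, the faces `lastOn_truncRun`,
`lastOn_toClusterTower_of_stepSchemaLast`; transitively 14′–16′, module 9's STRIP consumer, module 13's coherence at `ofRecordAdm`, node00-def-W1 g4's `runTowers` ∕
`toClusterTower`) BY NAME.  `--supports` K3′ (helper).

WHAT.
* §1 `n22At_u3OfRecord₁₂_w1Reading_of_n18Below_termwise226OnOlder_lastOn` — PIN-AGNOSTIC ENGINE (15′ §2 with the `EHoloAt` family REPLACED by the conditional clause
  `hlastOn`): any W1 reading `D`, readings of the abstract run-A slot in the spaces, `h226TOnOlder` + `hlastOn` for `D.S k`, N18 below, (C1)(C2)(J), numerals ⟹ `N22At`.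
* §2 ★ `n22At_u3OfRecord₁₂_ofRecordAdm_runTowers_of_n18Below_termwise226OnOlder_lastOn` — at `ReadingData.ofRecordAdm F M N (runTowers S₀) …`: NO readings ∕ coherence ∕
  (J) clauses; `h226TOnOlder` and `hlastOn` asked for the UNTRUNCATED `S₀ k` BELOW THE RUN LENGTH only.
* §3 ★ `n22At_u3OfRecord₁₂_ofRecordAdm_runTowers_toClusterTower_of_n18Below_threeSchemas` — at `S₀ k := toClusterTower (Gn k)`: `N22At` ⇐ (S-loc)+(S-226)+(S-last) at
  the steps below the run length (GENERATOR LANGUAGE: no couplings, no histories, no towers) + N18 below + `hspk` + numerals.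
* §4 ★ `s_N22_readingOfRecord₁₂_ofRecordAdm_runTowers_toClusterTower_of_s_N18_threeSchemas` — THE ₁₂ EDGE at that reading (dag-n18-d's `S_N18` home): `S_N18` + signs +
  per `(F, θ, k)` ∃(setting ∕ letters ∕ socket tuple; `hspk`; numerals; the three schemas below the run) ⟹ `S_N22`.

HONEST FRAMING.  Count-neutral by-name knit; NOT a discharge of N22: the three schemas are DISPLAYED hypothesis schemas on an abstract generator, asserted nowhere
((S-loc)+(S-226) = [II] (2.14)–(2.26) per term with complex old terms on a common domain — node N10's lane; (S-last) = [I] p. 263's clause for the one-step map,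
conditional on (1.18) for the old terms — node N09's lane; neither PRINTED as such); `S_N18` ∕ `N18At` below the run length is node N18's stub (N22's U3-sibling, consumed
as a hypothesis along ROAD 3 — an edge-table word is dag-lead's); the numerals are witnessed at every `M` by module 17′ but are the reading's; `hT₀` is a displayed
parameter of the reading; the generator `Gn` ∕ towers `S₀` are PARAMETERS (ref-F STANDING CHECK (g): counts only with NODE 00's generator of record, not typed yet);
statements at `ofRecordAdm` are vacuous where `AdmBg … k = ∅` (ref-H A1 WATCH).  NE5 ∕ NE9 NOT IN PRINT; one finite four-torus programme at fixed ε — NOT infinite volume, NOT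
OS on ℝ⁴, NOT a mass gap, NOT Clay.  0 `sorry`, 0 `def`, standard axioms.

References (TYPES only): [I] = [Balaban1987RG1] (0.23)–(0.25) pp. 256–257, Thm 1 p. 259, §1 p. 263, pp. 266–267, (2.12)–(2.13) p. 268; [II] = [Balaban1988RG2Cluster]
(2.13)–(2.15) pp. 14–15, (2.26) p. 17, (2.40)–(2.41) p. 21.
-/
noncomputable section

open scoped Matrix.Norms.L2Operator

namespace YMDAG.N22.W1

open Set Metric
open scoped BigOperators
open Literature.MathematicalPhysics.QuantumFieldTheory.Balaban1983to89
open Literature.MathematicalPhysics.QuantumFieldTheory.Balaban1983to89.T4Continuum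
open Literature.MathematicalPhysics.QuantumFieldTheory.Balaban1983to89.T4OutputRate
open Literature.MathematicalPhysics.QuantumFieldTheory.Balaban1983to89.TreeLengthTorus (TPt TDom tsys torusTreeLen torusTreeLen_nonneg)
open Literature.MathematicalPhysics.QuantumFieldTheory.Balaban1983to89.B12TreeDecay (K₀ K₀_pos)
open Literature.MathematicalPhysics.QuantumFieldTheory.Balaban1983to89.B13Lemma3TorusData (TBond)
open Literature.MathematicalPhysics.QuantumFieldTheory.Balaban1983to89.B13Lemma3TorusTerms (terms weight weight_nonneg)
open Literature.MathematicalPhysics.QuantumFieldTheory.Balaban1983to89.B13Lemma3TorusSocket (Lemma3Numerics)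
open Literature.MathematicalPhysics.QuantumFieldTheory.Balaban1983to89.Step (SFConsts)
open Literature.MathematicalPhysics.QuantumFieldTheory.Balaban1983to89.Node00
  (Stage12Params IsDatumOfRecord₁₂C U3Objects₁₁ U3Letters₁₁ MatA ιSU prependCoupling)
open Literature.MathematicalPhysics.QuantumFieldTheory.Balaban1983to89.Node00.Sect2 (domSys domCount CPair ofBackgroundC spaceI domSites Setting Residual)
open Literature.MathematicalPhysics.QuantumFieldTheory.Balaban1983to89.Node00.W1
open YMDAG.UVSplit

variable {N : ℕ} [NeZero N]

/-! ## §1 The pin-agnostic engine with the last coupling in the conditional shape -/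

section AnyReading

variable {F : T4Family} (θ : Stage12Params F N) {𝔸 : Type*} [NormedRing 𝔸] [NormedAlgebra ℂ 𝔸] [CompleteSpace 𝔸] {G : Type*} [GaugeGroup G]
  {M : ℕ} (D : ReadingData F 𝔸 M) (k : ℕ)
  (Sg : Setting 𝔸 G) (Rz : Residual (F.P k) 𝔸)

open Classical in
/-- **`N22At` AT THE LEVEL-`k` BUNDLE OF ANY W1 READING, THE LAST COUPLING IN THE CONDITIONAL SHAPE** (module 9 §2's STRIP consumer with STRIP from module 18′ §1's
self-feeding producer for the tower `D.S k` at the space table of record `U^c_j(Y, cs.α₀, cs.α₁)`): readings of the ABSTRACT run-A backgrounds inside the spaces (`hsp`), the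
OLDER-coupling level-T hypothesis UNIVERSAL IN THE DOMAIN (N10's lane), the conditional last-coupling clause `hlastOn` (N09's lane, print's [I] p. 263 shape), node N18 below
`k`, (C1)(C2)(J), the socket numerals + S25 + renewal, the letter signs ⟹ `N22At`. [cite: Balaban1987RG1, (0.23)-(0.25) pp.256-257, Thm 1 p.259, §1 p.263 and (1.18) p.263; Balaban1988RG2Cluster, (2.13)-(2.14) pp.14-15, (2.26) p.17 and (2.40)-(2.41) p.21] -/
theorem n22At_u3OfRecord₁₂_w1Reading_of_n18Below_termwise226OnOlder_lastOn [NeZero M] {cs : SFConsts}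
    (hsp : ∀ (j : ℕ) (U : (D.pairing k).BgA) (Y : (domSys (F.P k) M j).Dom), (D.pairing k).embA U ∈ spaceI Sg Rz M j (domSites (F.P k) M j Y) cs.α₀ cs.α₁)
    (c : B13.Consts) {L : ℕ} [NeZero L] (hL : 8 ≤ c.L) (hLc : c.L = L) {a a₂ a₂' a₅ Aabs : ℝ}
    (hN : Lemma3Numerics c M ((c.L : ℝ) / 2) a a₂ a₂' a₅ Aabs) {r₁ : ℝ} (hA0 : 0 ≤ c.C3act * c.ε₁) (hr₁ : 0 ≤ r₁) (hκ : D.li.κ ≤ r₁)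
    (hrate : r₁ + 2 * (64 * Real.log 162) + 2 ≤ (1 - 8 * c.δ) * ((c.L : ℝ) / 2) * c.κ)
    (hsmall : c.C3act * c.ε₁ * Real.exp (5 * r₁ + 1) * K₀ 64 8 * 9 * 64 ≤ 1)
    (hrenew : Real.exp 1 * 9 * 64 * K₀ 64 8 ^ 2 * (c.C3act * c.ε₁) ≤ D.li.A)
    (h226TOnOlder : ∀ (Dm : Set ℂ), IsOpen Dm → (∀ t ∈ Ioc (0 : ℝ) θ.γ, closedBall (t : ℂ) D.li.r ⊆ Dm) →
      ∀ (k' : ℕ) (g : ℕ → ℝ), g ∈ Window θ.γ → ∀ (i : ℕ), i < k' → ∀ (X : (domSys (F.P k) M (k' + 1)).Dom) (φ : CPair (F.P k) 𝔸),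
      φ ∈ spaceI Sg Rz M (k' + 1) (domSites (F.P k) M (k' + 1) X) cs.α₀ cs.α₁ →
      (∀ (j : ℕ), j < k' + 1 → ∀ (Y : (domSys (F.P k) M j).Dom) (ψ : CPair (F.P k) 𝔸), ψ ∈ spaceI Sg Rz M j (domSites (F.P k) M j Y) cs.α₀ cs.α₁ →
        ∃ Ec : ℂ → ℂ, DifferentiableOn ℂ Ec Dm ∧ (∀ z ∈ Dm, ‖Ec z‖ ≤ D.li.A * Real.exp (-(D.li.κ * torusTreeLen Y.1))) ∧
          (∀ t ∈ Ioc (0 : ℝ) θ.γ, Ec t = termC (D.S k) j Y (Function.update g i t) ψ)) →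
      ∃ (Hc : ℂ → TDom 4 (domCount (F.P k) M (k' + 1)) → ℂ)
        (Tt : (Z : TDom 4 (domCount (F.P k) M (k' + 1))) →
          Finset (TDom 4 (L * domCount (F.P k) M (k' + 1))) × Finset (TBond 4 M (L * domCount (F.P k) M (k' + 1))) → ℂ → ℂ),
        (∀ Z : (domSys (F.P k) M (k' + 1)).Dom, Z.1 ⊆ X.1 → DifferentiableOn ℂ (fun z => Hc z Z) Dm) ∧
        (∀ z ∈ Dm, ∀ Z : TDom 4 (domCount (F.P k) M (k' + 1)), Z.1 ⊆ X.1 → ‖Hc z Z‖ ≤ ∑ t ∈ terms L M Z, ‖Tt Z t z‖) ∧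
        (∀ z ∈ Dm, ∀ Z : TDom 4 (domCount (F.P k) M (k' + 1)), Z.1 ⊆ X.1 → ∀ t ∈ terms L M Z,
          ‖Tt Z t z‖ ≤ weight L M c Z a t * Real.exp (a₅ * ((Z.1).card : ℝ))) ∧
        (∀ t ∈ Ioc (0 : ℝ) θ.γ, Hc t = ((D.S k) k').H (restrictPrefix k' (Function.update g i t)) φ))
    (hlastOn : ∀ (g : ℕ → ℝ), g ∈ Window θ.γ → ∀ (k' : ℕ), ∃ U : Set ℂ, IsOpen U ∧ (∀ t ∈ Ioc (0 : ℝ) θ.γ, closedBall (t : ℂ) D.li.r ⊆ U) ∧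
      ((∀ (j : ℕ), j < k' + 1 → ∀ (Y : (domSys (F.P k) M j).Dom) (ψ : CPair (F.P k) 𝔸), ψ ∈ spaceI Sg Rz M j (domSites (F.P k) M j Y) cs.α₀ cs.α₁ →
          ‖termC (D.S k) j Y g ψ‖ ≤ D.li.A * Real.exp (-(D.li.κ * torusTreeLen Y.1))) →
        ∀ (X : (domSys (F.P k) M (k' + 1)).Dom) (φ : CPair (F.P k) 𝔸), φ ∈ spaceI Sg Rz M (k' + 1) (domSites (F.P k) M (k' + 1) X) cs.α₀ cs.α₁ →
          ∃ Ec : ℂ → ℂ, DifferentiableOn ℂ Ec U ∧ (∀ z ∈ U, ‖Ec z‖ ≤ D.li.A * Real.exp (-(D.li.κ * torusTreeLen X.1))) ∧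
            (∀ t ∈ Ioc (0 : ℝ) θ.γ, Ec t = termC (D.S k) (k' + 1) X (Function.update g k' t) φ)))
    (hfst : ∀ (k : ℕ) (X₁ : Node00.W1.Dom (F.P k) M), ((D.pairing k).pair X₁).1 = X₁.1 + 1)
    (hdj : ∀ (k : ℕ) (X₁ : Node00.W1.Dom (F.P k) M),
      (domSys (F.P (k + 1)) M ((D.pairing k).pair X₁).1).dj ((D.pairing k).pair X₁).2 = (domSys (F.P k) M X₁.1).dj X₁.2)
    (hsurj : ∀ (k : ℕ) (X : Node00.W1.Dom (F.P (k + 1)) M), 1 ≤ X.1 → ∃ X₁ : Node00.W1.Dom (F.P k) M, (D.pairing k).pair X₁ = X)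
    (hbg : ∀ (k : ℕ) (U : (D.pairing (k + 1)).BgA), ∃ U₁ : (D.pairing k).BgB, (D.pairing k).embB U₁ = (D.pairing (k + 1)).embA U)
    (hjunk : ∀ (k : ℕ) (g : ℕ → ℝ) (U : (D.pairing k).BgA) (X : Node00.W1.Dom (F.P k) M), k < X.1 → (D.pairing k).EA (D.S k) g U X = 0)
    (h18 : ∀ k' : ℕ, k' < k → N18At (u3OfRecord₁₂ θ (D.u3Objects θ.γ) k'))
    (hC5 : 0 ≤ D.li.C₅) (hθ1 : D.li.θ₅ < 1) (hC₀' : 2 * D.li.C₅ / (1 - D.li.θ₅) ≤ D.li.C₀)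
    (hC₀ : 0 < D.li.C₀) (hθ : 0 < D.li.θ₅) (hA : 0 < D.li.A) (hμ1 : 1 ≤ D.li.μ) (hθμ : D.li.θ₅ ≤ D.li.μ) (hCM : D.li.C₀ ≤ 2 * D.li.A)
    (hr : 0 < D.li.r) (hγ : 0 < θ.γ) (hs0 : 0 < D.li.s) (hs1 : D.li.s < 1) :
    N22At (u3OfRecord₁₂ θ (D.u3Objects θ.γ) k) :=
  n22At_u3OfRecord₁₂_w1Reading_of_n18Below_stripBound θ D k (fun j Y => spaceI Sg Rz M j (domSites (F.P k) M j Y) cs.α₀ cs.α₁) hsp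
    (stripBound_termC_of_termwise226OnOlder_lastOn F k Sg Rz (D.S k) c hL hLc hN hr.le hA0 hr₁ hκ hrate hsmall hrenew h226TOnOlder hlastOn)
    hfst hdj hsurj hbg hjunk h18 hC5 hθ1 hC₀' hC₀ hθ hA hμ1 hθμ hCM hr hγ hs0 hs1

end AnyReading

/-! ## §2 At the admissible reading of record on the towers of the runs of record — (J) discharged, both inputs below the run length -/

section RunTowers

variable {F : T4Family} {M : ℕ} (S₀ : (k : ℕ) → ClusterTower (F.P k) (MatA N) M)
  (sp : (k j : ℕ) → (domSys (F.P k) M j).Dom → Set (CPair (F.P k) (MatA N)))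
  (gauge : (k : ℕ) → GaugeField (F.P k) 0 (Node00.SU N) → GaugeField (F.P k) 0 (Node00.SU N) → ℝ) (hg : ∀ k U U', 0 ≤ gauge k U U')
  (T₀ : (k : ℕ) → GaugeField (F.P (k + 1)) 0 (Node00.SU N) → GaugeField (F.P k) 0 (Node00.SU N))
  (hT₀ : ∀ (k : ℕ) (U : GaugeField (F.P (k + 1)) 0 (Node00.SU N)),
    (∀ (j : ℕ) (Y : (domSys (F.P (k + 1)) M j).Dom), ofBackgroundC (ιSU N) U ∈ sp (k + 1) j Y) →
    ∀ (j : ℕ) (Y : (domSys (F.P k) M j).Dom), ofBackgroundC (ιSU N) (T₀ k U) ∈ sp k j Y)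
  (li : LetterInputs) (θ : Stage12Params F N) (k : ℕ) {G : Type*} [GaugeGroup G]
  (Sg : Setting (MatA N) G) (Rz : Residual (F.P k) (MatA N))

open Classical in
/-- **`N22At` AT THE LEVEL-`k` BUNDLE OF THE ADMISSIBLE READING OF RECORD ON THE TOWERS OF THE RUNS OF RECORD, LAST COUPLING CONDITIONAL** (`Dr :=
ReadingData.ofRecordAdm F M N (runTowers S₀) sp gauge hg T₀ hT₀ li`; 15′ §3 with the `EHoloAt` family REPLACED by `hlastOn`): no readings ∕ coherence ∕ (J) clauses; the
OLDER-coupling level-T hypothesis UNIVERSAL IN THE DOMAIN (N10) and the CONDITIONAL last-coupling clause (N09, [I] p. 263's shape) asked for the UNTRUNCATED `S₀ k` AT THE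
STEPS `k′ < k` ONLY (15′ §1, 18′ `lastOn_truncRun`); with N18 below, `hspk`, the socket numerals + S25 + renewal, the letter signs ⟹ `N22At (u3OfRecord₁₂ θ (Dr.u3Objects θ.γ) k)`.
[cite: Balaban1987RG1, (0.23)-(0.25) pp.256-257, Thm 1 p.259 and §1 p.263; Balaban1988RG2Cluster, (2.13)-(2.14) pp.14-15, (2.26) p.17 and (2.40)-(2.41) p.21] -/
theorem n22At_u3OfRecord₁₂_ofRecordAdm_runTowers_of_n18Below_termwise226OnOlder_lastOn [NeZero M] {cs : SFConsts}
    (hspk : ∀ (j : ℕ) (Y : (domSys (F.P k) M j).Dom), sp k j Y ⊆ spaceI Sg Rz M j (domSites (F.P k) M j Y) cs.α₀ cs.α₁)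
    (c : B13.Consts) {L : ℕ} [NeZero L] (hL : 8 ≤ c.L) (hLc : c.L = L) {a a₂ a₂' a₅ Aabs : ℝ}
    (hN : Lemma3Numerics c M ((c.L : ℝ) / 2) a a₂ a₂' a₅ Aabs) {r₁ : ℝ} (hA0 : 0 ≤ c.C3act * c.ε₁) (hr₁ : 0 ≤ r₁) (hκ : li.κ ≤ r₁)
    (hrate : r₁ + 2 * (64 * Real.log 162) + 2 ≤ (1 - 8 * c.δ) * ((c.L : ℝ) / 2) * c.κ)
    (hsmall : c.C3act * c.ε₁ * Real.exp (5 * r₁ + 1) * K₀ 64 8 * 9 * 64 ≤ 1)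
    (hrenew : Real.exp 1 * 9 * 64 * K₀ 64 8 ^ 2 * (c.C3act * c.ε₁) ≤ li.A)
    (h226TOnOlder : ∀ (Dm : Set ℂ), IsOpen Dm → (∀ t ∈ Ioc (0 : ℝ) θ.γ, closedBall (t : ℂ) li.r ⊆ Dm) →
      ∀ (k' : ℕ), k' < k → ∀ (g : ℕ → ℝ), g ∈ Window θ.γ → ∀ (i : ℕ), i < k' →
      ∀ (X : (domSys (F.P k) M (k' + 1)).Dom) (φ : CPair (F.P k) (MatA N)),
      φ ∈ spaceI Sg Rz M (k' + 1) (domSites (F.P k) M (k' + 1) X) cs.α₀ cs.α₁ →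
      (∀ (j : ℕ), j < k' + 1 → ∀ (Y : (domSys (F.P k) M j).Dom) (ψ : CPair (F.P k) (MatA N)), ψ ∈ spaceI Sg Rz M j (domSites (F.P k) M j Y) cs.α₀ cs.α₁ →
        ∃ Ec : ℂ → ℂ, DifferentiableOn ℂ Ec Dm ∧ (∀ z ∈ Dm, ‖Ec z‖ ≤ li.A * Real.exp (-(li.κ * torusTreeLen Y.1))) ∧
          (∀ t ∈ Ioc (0 : ℝ) θ.γ, Ec t = termC (S₀ k) j Y (Function.update g i t) ψ)) →
      ∃ (Hc : ℂ → TDom 4 (domCount (F.P k) M (k' + 1)) → ℂ)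
        (Tt : (Z : TDom 4 (domCount (F.P k) M (k' + 1))) →
          Finset (TDom 4 (L * domCount (F.P k) M (k' + 1))) × Finset (TBond 4 M (L * domCount (F.P k) M (k' + 1))) → ℂ → ℂ),
        (∀ Z : (domSys (F.P k) M (k' + 1)).Dom, Z.1 ⊆ X.1 → DifferentiableOn ℂ (fun z => Hc z Z) Dm) ∧
        (∀ z ∈ Dm, ∀ Z : TDom 4 (domCount (F.P k) M (k' + 1)), Z.1 ⊆ X.1 → ‖Hc z Z‖ ≤ ∑ t ∈ terms L M Z, ‖Tt Z t z‖) ∧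
        (∀ z ∈ Dm, ∀ Z : TDom 4 (domCount (F.P k) M (k' + 1)), Z.1 ⊆ X.1 → ∀ t ∈ terms L M Z,
          ‖Tt Z t z‖ ≤ weight L M c Z a t * Real.exp (a₅ * ((Z.1).card : ℝ))) ∧
        (∀ t ∈ Ioc (0 : ℝ) θ.γ, Hc t = ((S₀ k) k').H (restrictPrefix k' (Function.update g i t)) φ))
    (hlastOn : ∀ (g : ℕ → ℝ), g ∈ Window θ.γ → ∀ (k' : ℕ), k' < k → ∃ U : Set ℂ, IsOpen U ∧ (∀ t ∈ Ioc (0 : ℝ) θ.γ, closedBall (t : ℂ) li.r ⊆ U) ∧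
      ((∀ (j : ℕ), j < k' + 1 → ∀ (Y : (domSys (F.P k) M j).Dom) (ψ : CPair (F.P k) (MatA N)), ψ ∈ spaceI Sg Rz M j (domSites (F.P k) M j Y) cs.α₀ cs.α₁ →
          ‖termC (S₀ k) j Y g ψ‖ ≤ li.A * Real.exp (-(li.κ * torusTreeLen Y.1))) →
        ∀ (X : (domSys (F.P k) M (k' + 1)).Dom) (φ : CPair (F.P k) (MatA N)), φ ∈ spaceI Sg Rz M (k' + 1) (domSites (F.P k) M (k' + 1) X) cs.α₀ cs.α₁ →
          ∃ Ec : ℂ → ℂ, DifferentiableOn ℂ Ec U ∧ (∀ z ∈ U, ‖Ec z‖ ≤ li.A * Real.exp (-(li.κ * torusTreeLen X.1))) ∧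
            (∀ t ∈ Ioc (0 : ℝ) θ.γ, Ec t = termC (S₀ k) (k' + 1) X (Function.update g k' t) φ)))
    (h18 : ∀ k' : ℕ, k' < k → N18At (u3OfRecord₁₂ θ ((ReadingData.ofRecordAdm F M N (runTowers S₀) sp gauge hg T₀ hT₀ li).u3Objects θ.γ) k'))
    (hC5 : 0 ≤ li.C₅) (hθ1 : li.θ₅ < 1) (hC₀' : 2 * li.C₅ / (1 - li.θ₅) ≤ li.C₀)
    (hC₀ : 0 < li.C₀) (hθ : 0 < li.θ₅) (hA : 0 < li.A) (hμ1 : 1 ≤ li.μ) (hθμ : li.θ₅ ≤ li.μ) (hCM : li.C₀ ≤ 2 * li.A)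
    (hr : 0 < li.r) (hγ : 0 < θ.γ) (hs0 : 0 < li.s) (hs1 : li.s < 1) :
    N22At (u3OfRecord₁₂ θ ((ReadingData.ofRecordAdm F M N (runTowers S₀) sp gauge hg T₀ hT₀ li).u3Objects θ.γ) k) := by
  obtain ⟨hfst, hdj, hsurj, hbg⟩ := pairingCoherence_ofRecordAdm (N := N) (runTowers S₀) sp gauge hg T₀ hT₀ li
  refine n22At_u3OfRecord₁₂_w1Reading_of_n18Below_termwise226OnOlder_lastOn θ (ReadingData.ofRecordAdm F M N (runTowers S₀) sp gauge hg T₀ hT₀ li) k Sg Rz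
    (fun j U Y => hspk j Y (U.2 j Y)) c hL hLc hN hA0 hr₁ hκ hrate hsmall hrenew
    (termwise226OnOlder_truncRun k Sg Rz (S₀ k) k c (mul_nonneg hN.hα₆.le hN.hε₀) h226TOnOlder)
    (lastOn_truncRun k Sg Rz (S₀ k) k hA.le hlastOn) hfst hdj hsurj hbg (fun k₁ h U₁ X₁ hk₁ => ?_) h18
    hC5 hθ1 hC₀' hC₀ hθ hA hμ1 hθμ hCM hr hγ hs0 hs1
  show (functionalC (runTowers S₀ k₁) h (ofBackgroundC (ιSU N) U₁.1) X₁).re = 0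
  rw [(termlessBeyond_runTowers S₀ k₁).functionalC_eq_zero h _ X₁ hk₁, Complex.zero_re]

end RunTowers

/-! ## §3 On GENERATED towers: the three per-step generator schemas -/

section GeneratedReading

variable {F : T4Family} {M : ℕ} (Gn : (k : ℕ) → GenTower (F.P k) (MatA N) M)
  (sp : (k j : ℕ) → (domSys (F.P k) M j).Dom → Set (CPair (F.P k) (MatA N)))
  (gauge : (k : ℕ) → GaugeField (F.P k) 0 (Node00.SU N) → GaugeField (F.P k) 0 (Node00.SU N) → ℝ) (hg : ∀ k U U', 0 ≤ gauge k U U')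
  (T₀ : (k : ℕ) → GaugeField (F.P (k + 1)) 0 (Node00.SU N) → GaugeField (F.P k) 0 (Node00.SU N))
  (hT₀ : ∀ (k : ℕ) (U : GaugeField (F.P (k + 1)) 0 (Node00.SU N)),
    (∀ (j : ℕ) (Y : (domSys (F.P (k + 1)) M j).Dom), ofBackgroundC (ιSU N) U ∈ sp (k + 1) j Y) →
    ∀ (j : ℕ) (Y : (domSys (F.P k) M j).Dom), ofBackgroundC (ιSU N) (T₀ k U) ∈ sp k j Y)
  (li : LetterInputs) (θ : Stage12Params F N) (k : ℕ) {G : Type*} [GaugeGroup G]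
  (Sg : Setting (MatA N) G) (Rz : Residual (F.P k) (MatA N))

open Classical in
/-- **`N22At` AT THE ADMISSIBLE READING OF RECORD ON THE TOWERS OF THE RUNS OF RECORD GENERATED BY `Gn`, FROM THREE PER-STEP GENERATOR SCHEMAS** (§2 at
`S₀ k := toClusterTower (Gn k)`, its two coupling-shaped hypotheses SUPPLIED by 16′ §1 and 18′ `lastOn_toClusterTower_of_stepSchemaLast`): (S-loc) + (S-226) (node N10's
lane) + (S-last) (node N09's lane) at the steps `k′ < k` of the `k`-th torus — NO couplings, NO histories, NO towers in the displayed analytic inputs —, node N18 below, the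
`hspk` inclusion, the socket numerals + S25 + renewal, the letter signs ⟹ `N22At (u3OfRecord₁₂ θ (Dr.u3Objects θ.γ) k)`. [cite: Balaban1987RG1, (0.23)-(0.25) pp.256-257, §1 p.263 and (2.12)-(2.13) p.268; Balaban1988RG2Cluster, (2.13)-(2.15) pp.14-15, (2.26) p.17 and (2.40)-(2.41) p.21] -/
theorem n22At_u3OfRecord₁₂_ofRecordAdm_runTowers_toClusterTower_of_n18Below_threeSchemas [NeZero M] {cs : SFConsts}
    (hspk : ∀ (j : ℕ) (Y : (domSys (F.P k) M j).Dom), sp k j Y ⊆ spaceI Sg Rz M j (domSites (F.P k) M j Y) cs.α₀ cs.α₁)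
    (c : B13.Consts) {L : ℕ} [NeZero L] (hL : 8 ≤ c.L) (hLc : c.L = L) {a a₂ a₂' a₅ Aabs : ℝ}
    (hN : Lemma3Numerics c M ((c.L : ℝ) / 2) a a₂ a₂' a₅ Aabs) {r₁ : ℝ} (hA0 : 0 ≤ c.C3act * c.ε₁) (hr₁ : 0 ≤ r₁) (hκ : li.κ ≤ r₁)
    (hrate : r₁ + 2 * (64 * Real.log 162) + 2 ≤ (1 - 8 * c.δ) * ((c.L : ℝ) / 2) * c.κ)
    (hsmall : c.C3act * c.ε₁ * Real.exp (5 * r₁ + 1) * K₀ 64 8 * 9 * 64 ≤ 1)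
    (hrenew : Real.exp 1 * 9 * 64 * K₀ 64 8 ^ 2 * (c.C3act * c.ε₁) ≤ li.A)
    (hloc : ∀ (k' : ℕ), k' < k → ∀ (t : ℂ) (old old' : OlderTerms (F.P k) (MatA N) M k') (φ : CPair (F.P k) (MatA N))
      (Z : (domSys (F.P k) M (k' + 1)).Dom),
      (∀ (j : Fin (k' + 1)) (Y : (domSys (F.P k) M j).Dom) (ψ : CPair (F.P k) (MatA N)), ψ ∈ spaceI Sg Rz M j (domSites (F.P k) M j Y) cs.α₀ cs.α₁ →
        old j Y ψ = old' j Y ψ) → (Gn k k').H t old φ Z = (Gn k k').H t old' φ Z)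
    (h226G : ∀ (k' : ℕ), k' < k → ∀ (D : Set ℂ), IsOpen D → (∀ t ∈ Ioc (0 : ℝ) θ.γ, closedBall (t : ℂ) li.r ⊆ D) → ∀ (s : ℝ), s ∈ Ioc (0 : ℝ) θ.γ →
      ∀ (cv : ℂ → OlderTerms (F.P k) (MatA N) M k'),
      (∀ (j : Fin (k' + 1)) (Y : (domSys (F.P k) M j).Dom) (ψ : CPair (F.P k) (MatA N)), ψ ∈ spaceI Sg Rz M j (domSites (F.P k) M j Y) cs.α₀ cs.α₁ →
        DifferentiableOn ℂ (fun z => cv z j Y ψ) D ∧ ∀ z ∈ D, ‖cv z j Y ψ‖ ≤ li.A * Real.exp (-(li.κ * torusTreeLen Y.1))) →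
      ∀ (X : (domSys (F.P k) M (k' + 1)).Dom) (φ : CPair (F.P k) (MatA N)), φ ∈ spaceI Sg Rz M (k' + 1) (domSites (F.P k) M (k' + 1) X) cs.α₀ cs.α₁ →
      ∃ Tt : (Z : TDom 4 (domCount (F.P k) M (k' + 1))) →
          Finset (TDom 4 (L * domCount (F.P k) M (k' + 1))) × Finset (TBond 4 M (L * domCount (F.P k) M (k' + 1))) → ℂ → ℂ,
        (∀ Z : (domSys (F.P k) M (k' + 1)).Dom, Z.1 ⊆ X.1 → DifferentiableOn ℂ (fun z => (Gn k k').H (s : ℂ) (cv z) φ Z) D) ∧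
        (∀ z ∈ D, ∀ Z : TDom 4 (domCount (F.P k) M (k' + 1)), Z.1 ⊆ X.1 → ‖(Gn k k').H (s : ℂ) (cv z) φ Z‖ ≤ ∑ t ∈ terms L M Z, ‖Tt Z t z‖) ∧
        (∀ z ∈ D, ∀ Z : TDom 4 (domCount (F.P k) M (k' + 1)), Z.1 ⊆ X.1 → ∀ t ∈ terms L M Z,
          ‖Tt Z t z‖ ≤ weight L M c Z a t * Real.exp (a₅ * ((Z.1).card : ℝ))))
    (hlastG : ∀ (k' : ℕ), k' < k → ∀ (old : OlderTerms (F.P k) (MatA N) M k'), ∃ U : Set ℂ, IsOpen U ∧ (∀ t ∈ Ioc (0 : ℝ) θ.γ, closedBall (t : ℂ) li.r ⊆ U) ∧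
      ((∀ (j : Fin (k' + 1)) (Y : (domSys (F.P k) M j).Dom) (ψ : CPair (F.P k) (MatA N)), ψ ∈ spaceI Sg Rz M j (domSites (F.P k) M j Y) cs.α₀ cs.α₁ →
          ‖old j Y ψ‖ ≤ li.A * Real.exp (-(li.κ * torusTreeLen Y.1))) →
        ∀ (X : (domSys (F.P k) M (k' + 1)).Dom) (φ : CPair (F.P k) (MatA N)), φ ∈ spaceI Sg Rz M (k' + 1) (domSites (F.P k) M (k' + 1) X) cs.α₀ cs.α₁ →
          DifferentiableOn ℂ (fun z => (Gn k k').E z old φ X) U ∧ ∀ z ∈ U, ‖(Gn k k').E z old φ X‖ ≤ li.A * Real.exp (-(li.κ * torusTreeLen X.1))))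
    (h18 : ∀ k' : ℕ, k' < k →
      N18At (u3OfRecord₁₂ θ ((ReadingData.ofRecordAdm F M N (runTowers fun k => toClusterTower (Gn k)) sp gauge hg T₀ hT₀ li).u3Objects θ.γ) k'))
    (hC5 : 0 ≤ li.C₅) (hθ1 : li.θ₅ < 1) (hC₀' : 2 * li.C₅ / (1 - li.θ₅) ≤ li.C₀)
    (hC₀ : 0 < li.C₀) (hθ : 0 < li.θ₅) (hA : 0 < li.A) (hμ1 : 1 ≤ li.μ) (hθμ : li.θ₅ ≤ li.μ) (hCM : li.C₀ ≤ 2 * li.A)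
    (hr : 0 < li.r) (hγ : 0 < θ.γ) (hs0 : 0 < li.s) (hs1 : li.s < 1) :
    N22At (u3OfRecord₁₂ θ ((ReadingData.ofRecordAdm F M N (runTowers fun k => toClusterTower (Gn k)) sp gauge hg T₀ hT₀ li).u3Objects θ.γ) k) :=
  n22At_u3OfRecord₁₂_ofRecordAdm_runTowers_of_n18Below_termwise226OnOlder_lastOn (fun k => toClusterTower (Gn k)) sp gauge hg T₀ hT₀ li θ k Sg Rz
    hspk c hL hLc hN hA0 hr₁ hκ hrate hsmall hrenew (termwise226OnOlder_toClusterTower_of_stepSchemas k Sg Rz (Gn k) k c hloc h226G)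
    (lastOn_toClusterTower_of_stepSchemaLast k Sg Rz (Gn k) k hlastG) h18 hC5 hθ1 hC₀' hC₀ hθ hA hμ1 hθμ hCM hr hγ hs0 hs1

end GeneratedReading

/-! ## §4 THE ₁₂ EDGE N18 → N22 at the admissible reading of record on GENERATED towers, three schemas (edition-1 home) -/

section GeneratedEdge

variable (Gn : (F : T4Family) → (θ : Stage12Params F N) → (k : ℕ) → GenTower (F.P k) (MatA N) θ.τ9.M)
  (sp : (F : T4Family) → (θ : Stage12Params F N) → (k j : ℕ) → (domSys (F.P k) θ.τ9.M j).Dom → Set (CPair (F.P k) (MatA N)))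
  (gauge : (F : T4Family) → (θ : Stage12Params F N) → (k : ℕ) → GaugeField (F.P k) 0 (Node00.SU N) → GaugeField (F.P k) 0 (Node00.SU N) → ℝ)
  (hg : ∀ (F : T4Family) (θ : Stage12Params F N) (k : ℕ) (U U' : GaugeField (F.P k) 0 (Node00.SU N)), 0 ≤ gauge F θ k U U')
  (T₀ : (F : T4Family) → (θ : Stage12Params F N) → (k : ℕ) → GaugeField (F.P (k + 1)) 0 (Node00.SU N) → GaugeField (F.P k) 0 (Node00.SU N))
  (hT : ∀ (F : T4Family) (θ : Stage12Params F N) (k : ℕ) (U : GaugeField (F.P (k + 1)) 0 (Node00.SU N)),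
    (∀ (j : ℕ) (Y : (domSys (F.P (k + 1)) θ.τ9.M j).Dom), ofBackgroundC (ιSU N) U ∈ sp F θ (k + 1) j Y) →
      ∀ (j : ℕ) (X : (domSys (F.P k) θ.τ9.M j).Dom), ofBackgroundC (ιSU N) (T₀ F θ k U) ∈ sp F θ k j X)
  (li : (F : T4Family) → Stage12Params F N → LetterInputs) (ℓ₃ : T4Family → Node00.NE3Letters₁₁)
  (ne2 : (F : T4Family) → Stage12Params F N → (ℕ → ℝ) → List (ULoop F) → ℕ → Node00.NE2Objects₁₁)
  (ne1 : (F : T4Family) → Stage12Params F N → (ℕ → ℝ) → List (ULoop F) → NE1pCarriers) {G : Type*} [GaugeGroup G]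

open Classical in
/-- **THE EDGE N18 → N22 AT THE ADMISSIBLE READING OF RECORD ON THE GENERATED TOWERS OF THE RUNS OF RECORD, THREE SCHEMAS** (dag-n22-e's edition-1 home at
`w1 := fun F θ ↦ ReadingData.ofRecordAdm F θ.τ9.M N (runTowers fun k ↦ toClusterTower (Gn F θ k)) (sp F θ) …` — dag-n18-d g3's `s_N18_readingAdm₁₂_iff` home): node N18's stub
`S_N18 (RRec₁₂ 𝔯)` + the letter signs + per `(F, θ, k)` the EXISTENCE of: `NeZero θ.τ9.M`, a §2 setting `Sg` with residual recipes `Rz`, letters `cs` whose space table of record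
CONTAINS the run-length-`k` table (`hspk`), socket constants `c`, `L = c.L ≥ 8` with `NeZero L`, `Lemma3Numerics c θ.τ9.M (½c.L) …`, `0 ≤ C₃ε₁`, `0 ≤ r₁`, `li.κ ≤ r₁`, S25's two
clauses, the renewal, and the THREE PER-STEP GENERATOR SCHEMAS at the steps `k′ < k` of `Gn F θ k`: (S-loc), (S-226) (node N10's lane) and (S-last) (node N09's lane) ⟹ node
N22's stub `S_N22 (RRec₁₂ 𝔯)`.  NO coherence ∕ junk-freeness ∕ readings clause, NO `EHoloAt` family, NO coupling histories in the analytic inputs.  Datum form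
(`s_N22_rRec₁₂_w1_iff` at `pinnedInputs₁₂`, `s_N18_rRec₁₂_iff`), then §3. [cite: Balaban1987RG1, (0.23)-(0.25) pp.256-257, Thm 1 p.259, §1 p.263 and (2.12)-(2.13) p.268; Balaban1988RG2Cluster, (2.13)-(2.15) pp.14-15, (2.26) p.17 and (2.40)-(2.41) p.21] -/
theorem s_N22_readingOfRecord₁₂_ofRecordAdm_runTowers_toClusterTower_of_s_N18_threeSchemas
    (h18 : S_N18 (RRec₁₂ (readingOfRecord₁₂
      (fun F θ => ReadingData.ofRecordAdm F θ.τ9.M N (runTowers fun k => toClusterTower (Gn F θ k)) (sp F θ) (gauge F θ) (hg F θ) (T₀ F θ) (hT F θ)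
        (li F θ)) ℓ₃ ne2 ne1)))
    (hnum : ∀ (F : T4Family) (θ : Stage12Params F N), θ.Provisos₁₂ F N → θ.Admissible F N →
      0 < (li F θ).C₀ ∧ 0 < (li F θ).θ₅ ∧ (li F θ).θ₅ < 1 ∧ 0 ≤ (li F θ).C₅ ∧ 2 * (li F θ).C₅ / (1 - (li F θ).θ₅) ≤ (li F θ).C₀ ∧ 0 < (li F θ).A ∧
        (li F θ).θ₅ ≤ (li F θ).μ ∧ (li F θ).C₀ ≤ 2 * (li F θ).A ∧ 0 < (li F θ).r ∧ 0 < (li F θ).s ∧ (li F θ).s < 1 ∧ 1 ≤ (li F θ).μ)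
    (hdata : ∀ (F : T4Family) (θ : Stage12Params F N), θ.Provisos₁₂ F N → θ.Admissible F N → ∀ (k : ℕ),
      ∃ (_ : NeZero θ.τ9.M) (Sg : Setting (MatA N) G) (Rz : Residual (F.P k) (MatA N))
        (cs : SFConsts) (c : B13.Consts) (L : ℕ) (_ : NeZero L) (a a₂ a₂' a₅ Aabs r₁ : ℝ),
        (∀ (j : ℕ) (Y : (domSys (F.P k) θ.τ9.M j).Dom), sp F θ k j Y ⊆ spaceI Sg Rz θ.τ9.M j (domSites (F.P k) θ.τ9.M j Y) cs.α₀ cs.α₁) ∧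
        8 ≤ c.L ∧ c.L = L ∧ Lemma3Numerics c θ.τ9.M ((c.L : ℝ) / 2) a a₂ a₂' a₅ Aabs ∧ 0 ≤ c.C3act * c.ε₁ ∧ 0 ≤ r₁ ∧ (li F θ).κ ≤ r₁ ∧
        r₁ + 2 * (64 * Real.log 162) + 2 ≤ (1 - 8 * c.δ) * ((c.L : ℝ) / 2) * c.κ ∧
        c.C3act * c.ε₁ * Real.exp (5 * r₁ + 1) * K₀ 64 8 * 9 * 64 ≤ 1 ∧
        Real.exp 1 * 9 * 64 * K₀ 64 8 ^ 2 * (c.C3act * c.ε₁) ≤ (li F θ).A ∧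
        (∀ (k' : ℕ), k' < k → ∀ (t : ℂ) (old old' : OlderTerms (F.P k) (MatA N) θ.τ9.M k') (φ : CPair (F.P k) (MatA N))
          (Z : (domSys (F.P k) θ.τ9.M (k' + 1)).Dom),
          (∀ (j : Fin (k' + 1)) (Y : (domSys (F.P k) θ.τ9.M j).Dom) (ψ : CPair (F.P k) (MatA N)),
            ψ ∈ spaceI Sg Rz θ.τ9.M j (domSites (F.P k) θ.τ9.M j Y) cs.α₀ cs.α₁ → old j Y ψ = old' j Y ψ) →
          (Gn F θ k k').H t old φ Z = (Gn F θ k k').H t old' φ Z) ∧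
        (∀ (k' : ℕ), k' < k → ∀ (D : Set ℂ), IsOpen D → (∀ t ∈ Ioc (0 : ℝ) θ.γ, closedBall (t : ℂ) (li F θ).r ⊆ D) →
          ∀ (s : ℝ), s ∈ Ioc (0 : ℝ) θ.γ → ∀ (cv : ℂ → OlderTerms (F.P k) (MatA N) θ.τ9.M k'),
          (∀ (j : Fin (k' + 1)) (Y : (domSys (F.P k) θ.τ9.M j).Dom) (ψ : CPair (F.P k) (MatA N)),
            ψ ∈ spaceI Sg Rz θ.τ9.M j (domSites (F.P k) θ.τ9.M j Y) cs.α₀ cs.α₁ →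
            DifferentiableOn ℂ (fun z => cv z j Y ψ) D ∧ ∀ z ∈ D, ‖cv z j Y ψ‖ ≤ (li F θ).A * Real.exp (-((li F θ).κ * torusTreeLen Y.1))) →
          ∀ (X : (domSys (F.P k) θ.τ9.M (k' + 1)).Dom) (φ : CPair (F.P k) (MatA N)),
          φ ∈ spaceI Sg Rz θ.τ9.M (k' + 1) (domSites (F.P k) θ.τ9.M (k' + 1) X) cs.α₀ cs.α₁ →
          ∃ Tt : (Z : TDom 4 (domCount (F.P k) θ.τ9.M (k' + 1))) →
              Finset (TDom 4 (L * domCount (F.P k) θ.τ9.M (k' + 1))) × Finset (TBond 4 θ.τ9.M (L * domCount (F.P k) θ.τ9.M (k' + 1))) → ℂ → ℂ,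
            (∀ Z : (domSys (F.P k) θ.τ9.M (k' + 1)).Dom, Z.1 ⊆ X.1 → DifferentiableOn ℂ (fun z => (Gn F θ k k').H (s : ℂ) (cv z) φ Z) D) ∧
            (∀ z ∈ D, ∀ Z : TDom 4 (domCount (F.P k) θ.τ9.M (k' + 1)), Z.1 ⊆ X.1 →
              ‖(Gn F θ k k').H (s : ℂ) (cv z) φ Z‖ ≤ ∑ t ∈ terms L θ.τ9.M Z, ‖Tt Z t z‖) ∧
            (∀ z ∈ D, ∀ Z : TDom 4 (domCount (F.P k) θ.τ9.M (k' + 1)), Z.1 ⊆ X.1 → ∀ t ∈ terms L θ.τ9.M Z,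
              ‖Tt Z t z‖ ≤ weight L θ.τ9.M c Z a t * Real.exp (a₅ * ((Z.1).card : ℝ)))) ∧
        (∀ (k' : ℕ), k' < k → ∀ (old : OlderTerms (F.P k) (MatA N) θ.τ9.M k'), ∃ U : Set ℂ, IsOpen U ∧
          (∀ t ∈ Ioc (0 : ℝ) θ.γ, closedBall (t : ℂ) (li F θ).r ⊆ U) ∧
          ((∀ (j : Fin (k' + 1)) (Y : (domSys (F.P k) θ.τ9.M j).Dom) (ψ : CPair (F.P k) (MatA N)),
              ψ ∈ spaceI Sg Rz θ.τ9.M j (domSites (F.P k) θ.τ9.M j Y) cs.α₀ cs.α₁ → ‖old j Y ψ‖ ≤ (li F θ).A * Real.exp (-((li F θ).κ * torusTreeLen Y.1))) →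
            ∀ (X : (domSys (F.P k) θ.τ9.M (k' + 1)).Dom) (φ : CPair (F.P k) (MatA N)),
            φ ∈ spaceI Sg Rz θ.τ9.M (k' + 1) (domSites (F.P k) θ.τ9.M (k' + 1) X) cs.α₀ cs.α₁ →
            DifferentiableOn ℂ (fun z => (Gn F θ k k').E z old φ X) U ∧
              ∀ z ∈ U, ‖(Gn F θ k k').E z old φ X‖ ≤ (li F θ).A * Real.exp (-((li F θ).κ * torusTreeLen X.1))))) :
    S_N22 (RRec₁₂ (readingOfRecord₁₂
      (fun F θ => ReadingData.ofRecordAdm F θ.τ9.M N (runTowers fun k => toClusterTower (Gn F θ k)) (sp F θ) (gauge F θ) (hg F θ) (T₀ F θ) (hT F θ)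
        (li F θ)) ℓ₃ ne2 ne1)) := by
  refine (YMDAG.N22.s_N22_rRec₁₂_w1_iff (pinnedInputs₁₂ (fun F θ => ReadingData.ofRecordAdm F θ.τ9.M N (runTowers fun k => toClusterTower (Gn F θ k))
    (sp F θ) (gauge F θ) (hg F θ) (T₀ F θ) (hT F θ) (li F θ)) ℓ₃ ne2) ne1).2 fun F D h k => ?_
  have h18' : ∀ k' : ℕ, N18At (u3OfRecord₁₂ h.params
      ((ReadingData.ofRecordAdm F h.params.τ9.M N (runTowers fun k => toClusterTower (Gn F h.params k)) (sp F h.params) (gauge F h.params) (hg F h.params)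
        (T₀ F h.params) (hT F h.params) (li F h.params)).u3Objects h.params.γ) k') :=
    fun k' => (s_N18_rRec₁₂_iff (readingOfRecord₁₂ (fun F θ => ReadingData.ofRecordAdm F θ.τ9.M N (runTowers fun k => toClusterTower (Gn F θ k)) (sp F θ)
      (gauge F θ) (hg F θ) (T₀ F θ) (hT F θ) (li F θ)) ℓ₃ ne2 ne1)).1 h18 F D h (fun _ => 0) [] k'
  obtain ⟨hC₀, hθ, hθ1, hC5, hC₀', hA, hθμ, hCM, hr, hs0, hs1, hμ1⟩ := hnum F h.params h.provisos h.admissible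
  obtain ⟨hMz, Sg, Rz, cs, c, L, hLz, a, a₂, a₂', a₅, Aabs, r₁, hspk, hL, hLc, hN, hA0, hr₁, hκ, hrate, hsmall, hrenew, hloc, h226G, hlastG⟩ :=
    hdata F h.params h.provisos h.admissible k
  exact n22At_u3OfRecord₁₂_ofRecordAdm_runTowers_toClusterTower_of_n18Below_threeSchemas (Gn F h.params) (sp F h.params) (gauge F h.params) (hg F h.params)
    (T₀ F h.params) (hT F h.params) (li F h.params) h.params k Sg Rz hspk c hL hLc hN hA0 hr₁ hκ hrate hsmall hrenew hloc h226G hlastG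
    (fun k' _ => h18' k') hC5 hθ1 hC₀' hC₀ hθ hA hμ1 hθμ hCM hr h.gamma_pos hs0 hs1

end GeneratedEdge


end YMDAG.N22.W1

end
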